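import Literature.NumberTheory.Transcendental.PkappaThetaAddition
import Literature.NumberTheory.Transcendental.PhilipponZeroEstimateStd
import Mathlib.Algebra.MvPolynomial.Monad
import HarnessLib

/-!
# The addition law of the theta model of `M_κ` as polynomials; an addition law at every point

Topic: `Literature/NumberTheory/Transcendental`. A brick of the programme towards the named fact
`Literature.NumberTheory.Transcendental.philippon1986_std` (Philippon's zero estimate for the
groups `M_κ` in the theta embedding `GaGmE.Std.theta`): the translation structure of
`PkappaThetaAddition.lean` packaged in the polynomial ring `ℂ[X_J]`
(`MvPolynomial (Option β × ThetaIdx γ δ) ℂ`, the ring of `GaGmE.Std.thetaEval`), and the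
replacement for a COMPLETE SYSTEM of addition laws (Roy, LNM 1752, Ch. 11, §2.1: "there exist
finite complete systems of addition laws"; the constant `c(G)`), obtained by composing two laws
through a generic intermediate point. PROVED:

* `GaGmE.Std.addPoly u J = Q_J^{(u)} ∈ ℂ[X]₂` with `Q_J^{(u)}(Θ(w)) = μ(w, u) Θ_J(w + u)` for all
  `w, u` (`thetaEval_addPoly`; `addPoly_isHomogeneous`), coefficients entire in `u`
  (`coeffDifferentiable_addPoly`, in the sense `CoeffDifferentiable`: every coefficient is an entire
  function of the parameter);
* `GaGmE.Std.translate u P = P(Q^{(u)})` (`MvPolynomial.bind₁`): for `P` homogeneous of degree `D`,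
  `translate u P` is homogeneous of degree `2D` and
  `(translate u P)(Θ(w)) = μ(w, u)^D · P(Θ(w + u))` for ALL `w, u` (`thetaEval_translate`), with
  coefficients entire in `u` (`coeffDifferentiable_translate`) — Roy's polynomials
  `P(A(X, ψ_σ(z)))` of Prop. 3.6 (iv), whose degree in `X` does not depend on how often one
  differentiates in the translation parameter;
* `GaGmE.Std.lawPoly s z J = (Q_J^{(z+s)})^{(-s)} ∈ ℂ[X]₄` and
  `GaGmE.Std.lawUnit s w z = μ(w, -s)² μ(w - s, z + s)`: `lawPoly(Θ(w)) = lawUnit · Θ_J(w + z)` for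
  ALL `w, z` (`thetaEval_lawPoly`), `lawUnit` entire in `(w, z)` (`differentiable_lawUnit`),
  coefficients entire in `z` (`coeffDifferentiable_lawPoly`), and — completeness —
  **for every pair `(a, σ)` some auxiliary `s` has `lawUnit s a σ ≠ 0`** (`exists_lawUnit_ne_zero`,
  from `exists_aux_point`; `lawUnit_ne_zero_iff`). Summary: `exists_analytic_addition_law`.

So the theta model of `M_κ` carries, at EVERY pair of points, an addition law of degree `c = 4` in
the (polynomial) first argument, analytic in the second, with a unit that is an entire function —
exactly what the local-ring calculus of Roy §3 (translations `f ↦ f ∘ τ_σ` of regular functions,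
Lemma 3.1, Prop. 3.6 (iv)) consumes. Generic lemmas proved on the way: `eval_smul_of_isHomogeneous`
(`φ(c • x) = c^n φ(x)`), `eval_bind₁`, and the closure properties of `CoeffDifferentiable`
(sums, products, powers, `bind₁`, evaluation at a point: `CoeffDifferentiable.differentiable_eval`).

## References

* Yu. V. Nesterenko, P. Philippon (eds.), *Introduction to Algebraic Independence Theory*,
  LNM 1752, Springer 2001, Ch. 11 (D. Roy), §2.1 (addition laws, complete systems, `c(G)`),
  Lemma 3.1 and Prop. 3.6 (iv) with its proof (pp. 212–214). [NesterenkoPhilippon2001]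
* D. W. Masser, G. Wüstholz, *Zero estimates on group varieties I*, Invent. Math. 64 (1981),
  489–516, §2. [MasserWustholz1981]
* P. Philippon, *Lemmes de zéros dans les groupes algébriques commutatifs*, Bull. Soc. Math.
  France 114 (1986), 355–383, §2. [Philippon1986]
-/

noncomputable section

open Complex MvPolynomial
open scoped PeriodPair

namespace Literature.NumberTheory.Transcendental

/-! ### Two generic facts on multivariate polynomials -/

/-- Evaluation of a homogeneous polynomial at a scaled point: `φ(c • x) = c^n φ(x)`. [folklore] -/
theorem eval_smul_of_isHomogeneous {σ : Type*} {φ : MvPolynomial σ ℂ} {n : ℕ}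
    (hφ : φ.IsHomogeneous n) (c : ℂ) (x : σ → ℂ) :
    eval (c • x) φ = c ^ n * eval x φ := by
  classical
  simp only [eval_eq, Finset.mul_sum]
  refine Finset.sum_congr rfl fun d hd => ?_
  have hdeg : ∑ i ∈ d.support, d i = n := by
    have h := hφ (mem_support_iff.mp hd)
    simpa [Finsupp.weight_apply, Finsupp.sum] using h
  have hprod : ∏ i ∈ d.support, (c • x) i ^ d i = c ^ n * ∏ i ∈ d.support, x i ^ d i := by
    rw [← hdeg, ← Finset.prod_pow_eq_pow_sum, ← Finset.prod_mul_distrib]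
    exact Finset.prod_congr rfl fun i _ => by rw [Pi.smul_apply, smul_eq_mul, mul_pow]
  rw [hprod]
  ring

/-- Evaluation commutes with substitution: `eval x (bind₁ h φ) = eval (fun i => eval x (h i)) φ`.
[folklore] -/
theorem eval_bind₁ {σ τ : Type*} (x : τ → ℂ) (h : σ → MvPolynomial τ ℂ) (φ : MvPolynomial σ ℂ) :
    eval x (bind₁ h φ) = eval (fun i => eval x (h i)) φ := by
  change eval₂Hom (RingHom.id ℂ) x (bind₁ h φ) = eval₂Hom (RingHom.id ℂ) (fun i => eval₂Hom (RingHom.id ℂ) x (h i)) φ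
  exact eval₂Hom_bind₁ _ _ _ _

/-! ### Families of polynomials with holomorphic coefficients -/

section CoeffDifferentiable

variable {E : Type*} [NormedAddCommGroup E] [NormedSpace ℂ E] {σ : Type*}

/-- A family `u ↦ F(u)` of polynomials is **holomorphic** when every coefficient is an entire
function of `u`. [folklore] -/
def CoeffDifferentiable (F : E → MvPolynomial σ ℂ) : Prop :=
  ∀ m : σ →₀ ℕ, Differentiable ℂ fun u => coeff m (F u)

/-- Constant families are holomorphic. [folklore] -/
theorem coeffDifferentiable_const (P : MvPolynomial σ ℂ) :
    CoeffDifferentiable (fun _ : E => P) := fun _ => differentiable_const _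

/-- `u ↦ C(c(u))` is holomorphic for `c` entire. [folklore] -/
theorem coeffDifferentiable_C {c : E → ℂ} (hc : Differentiable ℂ c) :
    CoeffDifferentiable (fun u => (C (c u) : MvPolynomial σ ℂ)) := by
  classical
  intro m
  simp only [coeff_C]
  split_ifs
  · exact hc
  · exact differentiable_const _

/-- Sums of holomorphic families are holomorphic. [folklore] -/
theorem CoeffDifferentiable.add {F G : E → MvPolynomial σ ℂ} (hF : CoeffDifferentiable F)
    (hG : CoeffDifferentiable G) : CoeffDifferentiable fun u => F u + G u := fun m => by
  simp only [coeff_add]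
  exact (hF m).add (hG m)

/-- Finite sums of holomorphic families are holomorphic. [folklore] -/
theorem CoeffDifferentiable.sum {ι : Type*} (s : Finset ι) {F : ι → E → MvPolynomial σ ℂ}
    (hF : ∀ i ∈ s, CoeffDifferentiable (F i)) : CoeffDifferentiable fun u => ∑ i ∈ s, F i u := by
  intro m
  simp only [coeff_sum]
  exact Differentiable.fun_sum fun i hi => hF i hi m

/-- Products of holomorphic families are holomorphic (the coefficients of a product are finite sums
of products of coefficients). [folklore] -/
theorem CoeffDifferentiable.mul {F G : E → MvPolynomial σ ℂ} (hF : CoeffDifferentiable F)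
    (hG : CoeffDifferentiable G) : CoeffDifferentiable fun u => F u * G u := by
  classical
  intro m
  simp only [coeff_mul]
  exact Differentiable.fun_sum fun x _ => (hF x.1).mul (hG x.2)

/-- Finite products of holomorphic families are holomorphic. [folklore] -/
theorem CoeffDifferentiable.prod {ι : Type*} [DecidableEq ι] (s : Finset ι)
    {F : ι → E → MvPolynomial σ ℂ} (hF : ∀ i ∈ s, CoeffDifferentiable (F i)) :
    CoeffDifferentiable fun u => ∏ i ∈ s, F i u := by
  induction s using Finset.induction_on with
  | empty =>
    intro m
    simp only [Finset.prod_empty]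
    exact differentiable_const _
  | insert a s ha ih =>
    have h := (hF a (Finset.mem_insert_self a s)).mul
      (ih fun i hi => hF i (Finset.mem_insert_of_mem hi))
    intro m
    simpa only [Finset.prod_insert ha] using h m

/-- Powers of a holomorphic family are holomorphic. [folklore] -/
theorem CoeffDifferentiable.pow {F : E → MvPolynomial σ ℂ} (hF : CoeffDifferentiable F) (n : ℕ) :
    CoeffDifferentiable fun u => F u ^ n := by
  induction n with
  | zero =>
    intro m
    simp only [pow_zero]
    exact differentiable_const _
  | succ n ih =>
    have h := ih.mul hF
    intro m
    simpa only [pow_succ] using h m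

/-- Substituting a holomorphic family into a fixed polynomial gives a holomorphic family. [folklore] -/
theorem coeffDifferentiable_bind₁ {τ : Type*} {h : E → τ → MvPolynomial σ ℂ}
    (hh : ∀ i, CoeffDifferentiable fun u => h u i) (P : MvPolynomial τ ℂ) :
    CoeffDifferentiable fun u => MvPolynomial.bind₁ (h u) P := by
  classical
  have heq : (fun u => MvPolynomial.bind₁ (h u) P) =
      fun u => ∑ d ∈ P.support, C (coeff d P) * ∏ i ∈ d.support, h u i ^ d i := by
    funext u
    rw [← aeval_eq_bind₁, aeval_def, eval₂_eq]
    rfl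
  rw [heq]
  refine CoeffDifferentiable.sum _ fun d _ => ?_
  refine (coeffDifferentiable_C (differentiable_const _)).mul ?_
  exact CoeffDifferentiable.prod _ fun i _ => (hh i).pow _

/-- Evaluation of a holomorphic family of forms of a fixed degree at a fixed point is an entire
function of the parameter (a finite sum over the monomials of that degree). [folklore] -/
theorem CoeffDifferentiable.differentiable_eval [Finite σ] {F : E → MvPolynomial σ ℂ}
    (hF : CoeffDifferentiable F) {n : ℕ} (hn : ∀ u, (F u).IsHomogeneous n) (x : σ → ℂ) :
    Differentiable ℂ fun u => eval x (F u) := by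
  classical
  haveI : Fintype σ := Fintype.ofFinite σ
  -- the finite set of exponents of degree `n`
  set S : Finset (σ →₀ ℕ) := (Finset.finsuppAntidiag (Finset.univ : Finset σ) n) with hS
  have hsupp : ∀ u, (F u).support ⊆ S := by
    intro u d hd
    rw [hS, Finset.mem_finsuppAntidiag]
    refine ⟨?_, fun i _ => Finset.mem_univ i⟩
    have h := hn u (mem_support_iff.mp hd)
    rw [← Finset.sum_subset (Finset.subset_univ d.support)
      (fun i _ hi => Finsupp.notMem_support_iff.mp hi)]
    simpa [Finsupp.weight_apply, Finsupp.sum] using h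
  have heq : (fun u => eval x (F u)) = fun u => ∑ d ∈ S, coeff d (F u) * ∏ i ∈ d.support, x i ^ d i := by
    funext u
    rw [eval_eq]
    exact Finset.sum_subset (hsupp u) fun d _ hd => by
      rw [notMem_support_iff.mp hd, zero_mul]
  rw [heq]
  exact Differentiable.fun_sum fun d _ => (hF d).mul (differentiable_const _)

end CoeffDifferentiable

namespace GaGmE

namespace Std

variable {β γ δ : Type} [Fintype β] [Fintype γ] [Fintype δ] [DecidableEq γ]
variable (L : PeriodPair) (κM : δ → γ → Kbar)

/-! ### The law as quadratic polynomials in the theta coordinates -/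

/-- **The addition law of the theta model as polynomials**: for `u ∈ Lie M_κ,ℂ` and a theta index
`J`, the quadratic form `Q_J^{(u)} ∈ ℂ[X]₂` with `Q_J^{(u)}(Θ(w)) = μ(w, u) Θ_J(w + u)`
(`thetaEval_addPoly`); coefficients from `PkappaThetaAddition.lean`. [folklore] -/
def addPoly (u : β ⊕ (γ ⊕ δ) → ℂ) :
    Option β × ThetaIdx γ δ → MvPolynomial (Option β × ThetaIdx γ δ) ℂ
  | (a, (M, none)) => ∑ J : γ → Fin 3, ∑ K : γ → Fin 3,
      C (thetaT (γ := γ) (δ := δ) a u * addCoeffP L M J K u) *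
        (X (a, (J, none)) * X (none, (K, none)))
  | (a, (M, some e)) => ∑ J : γ → Fin 3, ∑ K : γ → Fin 3,
      C (thetaT (γ := γ) (δ := δ) a u * addCoeffP L M J K u) *
        (X (a, (J, some e)) * X (none, (K, none))) +
      ∑ J : γ → Fin 3, ∑ K : γ → Fin 3,
        C (thetaT (γ := γ) (δ := δ) a u * addCoeffS L κM M e J K u) *
          (X (a, (J, none)) * X (none, (K, none)))

omit [Fintype β] [Fintype δ] in
/-- The law is a quadratic form. [folklore] -/
theorem addPoly_isHomogeneous (u : β ⊕ (γ ⊕ δ) → ℂ) (J : Option β × ThetaIdx γ δ) :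
    (addPoly L κM u J).IsHomogeneous 2 := by
  have hXX : ∀ J₁ J₂ : Option β × ThetaIdx γ δ, ∀ c : ℂ,
      (C c * (X J₁ * X J₂) : MvPolynomial (Option β × ThetaIdx γ δ) ℂ).IsHomogeneous 2 := by
    intro J₁ J₂ c
    simpa using ((isHomogeneous_X ℂ J₁).mul (isHomogeneous_X ℂ J₂)).C_mul c
  obtain ⟨a, M, _ | e⟩ := J
  · exact IsHomogeneous.sum _ _ _ fun J _ => IsHomogeneous.sum _ _ _ fun K _ => hXX _ _ _
  · exact (IsHomogeneous.sum _ _ _ fun J _ => IsHomogeneous.sum _ _ _ fun K _ => hXX _ _ _).add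
      (IsHomogeneous.sum _ _ _ fun J _ => IsHomogeneous.sum _ _ _ fun K _ => hXX _ _ _)

omit [Fintype β] [Fintype δ] in
/-- **`Q_J^{(u)}(Θ(w)) = μ(w, u) Θ_J(w + u)`** for all `w, u`. [folklore] -/
theorem thetaEval_addPoly (u : β ⊕ (γ ⊕ δ) → ℂ) (J : Option β × ThetaIdx γ δ)
    (w : β ⊕ (γ ⊕ δ) → ℂ) :
    thetaEval L κM (addPoly L κM u J) w = addUnit (β := β) (δ := δ) L w u * theta L κM J (w + u) := by
  obtain ⟨a, M, _ | e⟩ := J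
  · rw [theta_add_none]
    simp [addPoly, thetaEval, map_sum, map_mul, eval_C, eval_X]
  · rw [theta_add_some]
    simp [addPoly, thetaEval, map_sum, map_mul, map_add, eval_C, eval_X]

/-- The coefficients of the law are entire functions of `u`. [folklore] -/
theorem coeffDifferentiable_addPoly (J : Option β × ThetaIdx γ δ) :
    CoeffDifferentiable fun u : β ⊕ (γ ⊕ δ) → ℂ => addPoly L κM u J := by
  have hT : ∀ a : Option β, Differentiable ℂ fun u : β ⊕ (γ ⊕ δ) → ℂ => thetaT (γ := γ) (δ := δ) a u :=
    fun a => differentiable_thetaT a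
  obtain ⟨a, M, _ | e⟩ := J
  · simp only [addPoly]
    refine CoeffDifferentiable.sum _ fun J _ => CoeffDifferentiable.sum _ fun K _ => ?_
    exact (coeffDifferentiable_C ((hT a).mul (differentiable_addCoeffP L M J K))).mul
      (coeffDifferentiable_const _)
  · simp only [addPoly]
    refine (CoeffDifferentiable.sum _ fun J _ => CoeffDifferentiable.sum _ fun K _ => ?_).add
      (CoeffDifferentiable.sum _ fun J _ => CoeffDifferentiable.sum _ fun K _ => ?_)
    · exact (coeffDifferentiable_C ((hT a).mul (differentiable_addCoeffP L M J K))).mul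
        (coeffDifferentiable_const _)
    · exact (coeffDifferentiable_C ((hT a).mul (differentiable_addCoeffS L κM M e J K))).mul
        (coeffDifferentiable_const _)

/-! ### Translation of forms -/

/-- **Translation of a form by `u`**: `P ↦ P^{(u)} = P(Q^{(u)})` (substitution of the law), so
that `P^{(u)}(Θ(w)) = μ(w, u)^D P(Θ(w + u))` for `P` of degree `D` (`thetaEval_translate`).
[cite: NesterenkoPhilippon2001, Ch. 11 Prop. 3.6 (iv) (the set F of polynomials P(A(X, ψ_σ(z))))] -/
def translate (u : β ⊕ (γ ⊕ δ) → ℂ) (P : MvPolynomial (Option β × ThetaIdx γ δ) ℂ) :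
    MvPolynomial (Option β × ThetaIdx γ δ) ℂ :=
  bind₁ (addPoly L κM u) P

omit [Fintype β] [Fintype δ] in
/-- The translate of a form of degree `D` is a form of degree `2D`. [folklore] -/
theorem translate_isHomogeneous (u : β ⊕ (γ ⊕ δ) → ℂ) {P : MvPolynomial (Option β × ThetaIdx γ δ) ℂ}
    {D : ℕ} (hP : P.IsHomogeneous D) : (translate L κM u P).IsHomogeneous (2 * D) := by
  rw [translate, ← aeval_eq_bind₁]
  exact hP.aeval _ (addPoly_isHomogeneous L κM u)

omit [Fintype β] [Fintype δ] in
/-- **`P^{(u)}(Θ(w)) = μ(w, u)^D · P(Θ(w + u))`** for `P` homogeneous of degree `D` and all `w, u`.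
[folklore] -/
theorem thetaEval_translate (u : β ⊕ (γ ⊕ δ) → ℂ) {P : MvPolynomial (Option β × ThetaIdx γ δ) ℂ}
    {D : ℕ} (hP : P.IsHomogeneous D) (w : β ⊕ (γ ⊕ δ) → ℂ) :
    thetaEval L κM (translate L κM u P) w =
      addUnit (β := β) (δ := δ) L w u ^ D * thetaEval L κM P (w + u) := by
  unfold thetaEval translate
  rw [eval_bind₁]
  have h : (fun J => eval (fun J' => theta L κM J' w) (addPoly L κM u J)) =
      addUnit (β := β) (δ := δ) L w u • fun J => theta L κM J (w + u) := by
    funext J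
    exact thetaEval_addPoly L κM u J w
  rw [h, eval_smul_of_isHomogeneous hP]

/-- The coefficients of the translates of a fixed form are entire functions of `u`. [folklore] -/
theorem coeffDifferentiable_translate (P : MvPolynomial (Option β × ThetaIdx γ δ) ℂ) :
    CoeffDifferentiable fun u : β ⊕ (γ ⊕ δ) → ℂ => translate L κM u P :=
  coeffDifferentiable_bind₁ (coeffDifferentiable_addPoly L κM) P

/-! ### Composition through an auxiliary point: the analytic addition law at every point -/

/-- **The composed law** through the auxiliary point `s`: the quartic forms
`R_J^{(s; z)} = (Q_J^{(z + s)})^{(-s)} ∈ ℂ[X]₄` expressing `Θ_J(w + z)` through `Θ(w)` via the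
intermediate point `w - s`. [folklore] -/
def lawPoly (s z : β ⊕ (γ ⊕ δ) → ℂ) (J : Option β × ThetaIdx γ δ) :
    MvPolynomial (Option β × ThetaIdx γ δ) ℂ :=
  translate L κM (-s) (addPoly L κM (z + s) J)

/-- **The unit of the composed law**: `U_s(w, z) = μ(w, -s)² μ(w - s, z + s)`. [folklore] -/
def lawUnit (s w z : β ⊕ (γ ⊕ δ) → ℂ) : ℂ :=
  addUnit (β := β) (δ := δ) L w (-s) ^ 2 * addUnit (β := β) (δ := δ) L (w - s) (z + s)

omit [Fintype β] [Fintype δ] in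
/-- The composed law is a quartic form. [folklore] -/
theorem lawPoly_isHomogeneous (s z : β ⊕ (γ ⊕ δ) → ℂ) (J : Option β × ThetaIdx γ δ) :
    (lawPoly L κM s z J).IsHomogeneous 4 := by
  unfold lawPoly
  simpa using translate_isHomogeneous L κM (-s) (addPoly_isHomogeneous L κM (z + s) J)

omit [Fintype β] [Fintype δ] in
/-- **`R_J^{(s;z)}(Θ(w)) = U_s(w, z) · Θ_J(w + z)`** for ALL `w, z` (and every auxiliary `s`).
[folklore] -/
theorem thetaEval_lawPoly (s z : β ⊕ (γ ⊕ δ) → ℂ) (J : Option β × ThetaIdx γ δ)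
    (w : β ⊕ (γ ⊕ δ) → ℂ) :
    thetaEval L κM (lawPoly L κM s z J) w = lawUnit (β := β) (δ := δ) L s w z * theta L κM J (w + z) := by
  rw [lawPoly, thetaEval_translate L κM (-s) (addPoly_isHomogeneous L κM (z + s) J), thetaEval_addPoly,
    lawUnit, ← sub_eq_add_neg, show w - s + (z + s) = w + z by abel]
  ring

omit [Fintype β] [Fintype δ] [DecidableEq γ] in
/-- **Where the composed law is good**: `U_s(w, z) ≠ 0` iff `z'_b(w) + z'_b(s) ∉ Λ` and
`z'_b(w) - z'_b(s) - (z'_b(z) + z'_b(s)) ∉ Λ` for all blocks `b`. [folklore] -/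
theorem lawUnit_ne_zero_iff (s w z : β ⊕ (γ ⊕ δ) → ℂ) :
    lawUnit (β := β) (δ := δ) L s w z ≠ 0 ↔
      (∀ b, w (iz b) + s (iz b) ∉ L.lattice) ∧
        ∀ b, w (iz b) - s (iz b) - (z (iz b) + s (iz b)) ∉ L.lattice := by
  rw [lawUnit, mul_ne_zero_iff, pow_ne_zero_iff two_ne_zero, addUnit_ne_zero_iff,
    addUnit_ne_zero_iff]
  simp only [Pi.neg_apply, sub_neg_eq_add, Pi.sub_apply, Pi.add_apply]

omit [Fintype β] [Fintype δ] [DecidableEq γ] in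
/-- **Completeness: at every pair of points some composed law is good.** For all
`a, σ ∈ Lie M_κ,ℂ` there is an auxiliary `s` with `U_s(a, σ) ≠ 0` (then `U_s ≠ 0` near `(a, σ)` by
continuity). This replaces a complete system of addition laws (Roy, LNM 1752, Ch. 11, §2.1) for
the theta model of `M_κ`. [folklore] -/
theorem exists_lawUnit_ne_zero (a σ : β ⊕ (γ ⊕ δ) → ℂ) :
    ∃ s : β ⊕ (γ ⊕ δ) → ℂ, lawUnit (β := β) (δ := δ) L s a σ ≠ 0 := by
  obtain ⟨s, h1, h2⟩ := exists_aux_point (β := β) (δ := δ) L a σ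
  refine ⟨s, (lawUnit_ne_zero_iff L s a σ).mpr ⟨h1, fun b => ?_⟩⟩
  have := h2 b
  rwa [show a (iz b) - s (iz b) - (σ (iz b) + s (iz b)) = a (iz b) - σ (iz b) - 2 * s (iz b) by ring]

/-- The unit of the composed law is an entire function of `(w, z)`. [folklore] -/
theorem differentiable_lawUnit (s : β ⊕ (γ ⊕ δ) → ℂ) :
    Differentiable ℂ fun p : (β ⊕ (γ ⊕ δ) → ℂ) × (β ⊕ (γ ⊕ δ) → ℂ) =>
      lawUnit (β := β) (δ := δ) L s p.1 p.2 := by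
  have hμ := differentiable_addUnit (β := β) (γ := γ) (δ := δ) L
  have h1 : Differentiable ℂ fun p : (β ⊕ (γ ⊕ δ) → ℂ) × (β ⊕ (γ ⊕ δ) → ℂ) =>
      addUnit (β := β) (δ := δ) L p.1 (-s) :=
    hμ.comp (f := fun p : (β ⊕ (γ ⊕ δ) → ℂ) × (β ⊕ (γ ⊕ δ) → ℂ) => (p.1, -s)) (by fun_prop)
  have h2 : Differentiable ℂ fun p : (β ⊕ (γ ⊕ δ) → ℂ) × (β ⊕ (γ ⊕ δ) → ℂ) =>
      addUnit (β := β) (δ := δ) L (p.1 - s) (p.2 + s) :=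
    hμ.comp (f := fun p : (β ⊕ (γ ⊕ δ) → ℂ) × (β ⊕ (γ ⊕ δ) → ℂ) => (p.1 - s, p.2 + s))
      (by fun_prop)
  unfold lawUnit
  exact (h1.pow 2).mul h2

/-- The unit of the composed law is continuous; in particular it stays non-zero near a good pair.
[folklore] -/
theorem continuous_lawUnit (s : β ⊕ (γ ⊕ δ) → ℂ) :
    Continuous fun p : (β ⊕ (γ ⊕ δ) → ℂ) × (β ⊕ (γ ⊕ δ) → ℂ) =>
      lawUnit (β := β) (δ := δ) L s p.1 p.2 :=
  (differentiable_lawUnit L s).continuous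

/-- The coefficients of the composed law are entire functions of the translation parameter `z`
(for fixed auxiliary `s`). [folklore] -/
theorem coeffDifferentiable_lawPoly (s : β ⊕ (γ ⊕ δ) → ℂ) (J : Option β × ThetaIdx γ δ) :
    CoeffDifferentiable fun z : β ⊕ (γ ⊕ δ) → ℂ => lawPoly L κM s z J := by
  classical
  -- `z ↦ bind₁ (addPoly (-s)) (addPoly (z + s) J)`: a FIXED substitution applied to a holomorphic
  -- family of quadratic forms — the coefficients depend linearly on those of the family
  have h : CoeffDifferentiable fun z : β ⊕ (γ ⊕ δ) → ℂ => addPoly L κM (z + s) J := by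
    intro m
    exact ((coeffDifferentiable_addPoly L κM J) m).comp (differentiable_id.add_const s)
  have heq : (fun z : β ⊕ (γ ⊕ δ) → ℂ => MvPolynomial.bind₁ (addPoly L κM (-s)) (addPoly L κM (z + s) J)) =
      fun z => ∑ d ∈ (Finset.finsuppAntidiag (Finset.univ : Finset (Option β × ThetaIdx γ δ)) 2),
        C (coeff d (addPoly L κM (z + s) J)) * ∏ i ∈ d.support, addPoly L κM (-s) i ^ d i := by
    funext z
    rw [← aeval_eq_bind₁, aeval_def, eval₂_eq]
    refine Finset.sum_subset (fun d hd => ?_) fun d _ hd => by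
      rw [notMem_support_iff.mp hd, map_zero, zero_mul]
    rw [Finset.mem_finsuppAntidiag]
    refine ⟨?_, fun i _ => Finset.mem_univ i⟩
    have hh := addPoly_isHomogeneous L κM (z + s) J (mem_support_iff.mp hd)
    rw [← Finset.sum_subset (Finset.subset_univ d.support)
      (fun i _ hi => Finsupp.notMem_support_iff.mp hi)]
    simpa [Finsupp.weight_apply, Finsupp.sum] using hh
  unfold lawPoly translate
  rw [heq]
  exact CoeffDifferentiable.sum _ fun d _ => (coeffDifferentiable_C (h d)).mul (coeffDifferentiable_const _)

/-- **The analytic addition law at every point** (summary): for all `a, σ ∈ Lie M_κ,ℂ` there are an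
auxiliary `s`, an entire unit `U = U_s` with `U(a, σ) ≠ 0`, and quartic forms `R_J^{(z)}` whose
coefficients are entire in `z`, with `R_J^{(z)}(Θ(w)) = U(w, z) Θ_J(w + z)` for ALL `w, z, J`.
[cite: NesterenkoPhilippon2001, Ch. 11 §2.1 (complete systems of addition laws; c(G)) and Prop. 3.6 (iv)] -/
theorem exists_analytic_addition_law (a σ : β ⊕ (γ ⊕ δ) → ℂ) :
    ∃ s : β ⊕ (γ ⊕ δ) → ℂ, lawUnit (β := β) (δ := δ) L s a σ ≠ 0 ∧
      (∀ z J, (lawPoly L κM s z J).IsHomogeneous 4) ∧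
      (∀ J, CoeffDifferentiable fun z : β ⊕ (γ ⊕ δ) → ℂ => lawPoly L κM s z J) ∧
      (Differentiable ℂ fun p : (β ⊕ (γ ⊕ δ) → ℂ) × (β ⊕ (γ ⊕ δ) → ℂ) =>
        lawUnit (β := β) (δ := δ) L s p.1 p.2) ∧
      ∀ w z J, thetaEval L κM (lawPoly L κM s z J) w =
        lawUnit (β := β) (δ := δ) L s w z * theta L κM J (w + z) := by
  obtain ⟨s, hs⟩ := exists_lawUnit_ne_zero (β := β) (δ := δ) L a σ
  exact ⟨s, hs, lawPoly_isHomogeneous L κM s, coeffDifferentiable_lawPoly L κM s,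
    differentiable_lawUnit L s, fun w z J => thetaEval_lawPoly L κM s z J w⟩

end Std

end GaGmE

end Literature.NumberTheory.Transcendental

end
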